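import Summits.Ventures.PercRepro2.CaseOnePocketSplit
import Summits.Ventures.PercRepro2.CaseOneMoves

/-!
# A mark-free pocket is a pendant edge
(blind cell PercRepro2, p1 g27; the structural step behind the pocket reduction of the case-1 rung)

A **pocket** `(W, x, P)` of the graph `(E, ends)`: an interior `W ⊆ V`, a cut vertex `x ∉ W`, and `P`
exactly the edges touching `W`, each with both ends in `W ∪ {x}` (`IsPocket`). For a vertex `a₃ ∈ W` and
an edge `e₀ ∈ P` the **contracted graph** `pocketEnds ends P e₀ a₃ x` keeps every edge off `P`, makes
`e₀` the leaf edge `{x, a₃}` and every other edge of `P` a loop at `x`; the **contracted configuration**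
`pocketCfg ends P e₀ a₃ x ω` keeps the outside states, declares `e₀` open iff `a₃ ↔ x` through the
edges of `P` alone, and closes the other edges of `P`; the **contracted weights** `pocketW` give `e₀`
the probability `pocketProb = P_{inW P p}(a₃ ↔ x)` of that event and the other edges of `P` the weight
`0`. Then
* the product law pushes forward (`expect_pocket`, `prob_pocket`): split the law along `P`
  (`expect_split`), the inner expectation is a Bernoulli mixture in the state of `e₀`;
* in the contracted graph `a₃` is a leaf at `x` (`isLeafAt_pocketEnds`), and the contracted weights of a
  probability vector form a probability vector (`IsProbVec.pocketW`).
The connection lemmas (connections among vertices outside `W`, and those of `a₃` to the outside, are the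
same in both graphs) are in `CaseOnePocketConn`; the case-1 forms transfer in `CaseOnePocketForms`. Own
code; standard axioms. -/

namespace Summit.Ventures.PercRepro2

namespace CaseOne

/-! ## Pockets -/

section PocketDefs
variable {V : Type*} {E : Type*} [DecidableEq E]

/-- **A pocket**: interior `W`, cut vertex `x ∉ W`, `P` = the edges touching `W`, every such edge having
both ends in `W ∪ {x}`. -/
structure IsPocket (ends : E → Sym2 V) (W : Set V) (x : V) (P : Finset E) : Prop where
  /-- the cut vertex is outside the interior -/
  x_not_mem : x ∉ W
  /-- `P` is exactly the set of edges touching `W` -/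
  mem_iff : ∀ e, e ∈ P ↔ ∃ y ∈ W, y ∈ ends e
  /-- an edge touching `W` has both ends in `W ∪ {x}` -/
  ends_mem : ∀ e ∈ P, ∀ y ∈ ends e, y ∈ W ∨ y = x

variable {ends : E → Sym2 V} {W : Set V} {x : V} {P : Finset E}

omit [DecidableEq E] in
/-- An edge with an end in `W` belongs to `P`. -/
lemma IsPocket.mem_P (h : IsPocket ends W x P) {e : E} {y : V} (hy : y ∈ W) (hye : y ∈ ends e) :
    e ∈ P :=
  (h.mem_iff e).2 ⟨y, hy, hye⟩

omit [DecidableEq E] in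
/-- An edge off `P` has no end in `W`. -/
lemma IsPocket.not_mem_W (h : IsPocket ends W x P) {e : E} (he : e ∉ P) {y : V} (hye : y ∈ ends e) :
    y ∉ W :=
  fun hy => he (h.mem_P hy hye)

omit [DecidableEq E] in
/-- An edge of `P` with an end outside `W` has that end at `x`. -/
lemma IsPocket.eq_x (h : IsPocket ends W x P) {e : E} (he : e ∈ P) {y : V} (hye : y ∈ ends e)
    (hy : y ∉ W) : y = x :=
  (h.ends_mem e he y hye).resolve_left hy

/-- The contracted ends: `e₀` becomes the leaf edge `{x, a₃}`, the other edges of `P` loops at `x`. -/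
def pocketEnds (ends : E → Sym2 V) (P : Finset E) (e₀ : E) (a₃ x : V) : E → Sym2 V :=
  fun e => if e = e₀ then s(x, a₃) else if e ∈ P then s(x, x) else ends e

/-- The contracted configuration: outside states kept, `e₀` open iff `a₃ ↔ x` through the edges of `P`,
the other edges of `P` closed. -/
noncomputable def pocketCfg (ends : E → Sym2 V) (P : Finset E) (e₀ : E) (a₃ x : V) (ω : Config E) :
    Config E :=
  Function.update (outOnly P ω) e₀ (@decide (Conn ends (inOnly P ω) a₃ x) (Classical.dec _))

/-- The contracted end of `e₀` is the leaf edge `{x, a₃}`. -/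
@[simp] lemma pocketEnds_self (e₀ : E) (a₃ x : V) : pocketEnds ends P e₀ a₃ x e₀ = s(x, a₃) := by
  simp [pocketEnds]

/-- The other edges of `P` are loops at `x` in the contracted graph. -/
lemma pocketEnds_of_mem {e₀ e : E} (hne : e ≠ e₀) (he : e ∈ P) (a₃ x : V) :
    pocketEnds ends P e₀ a₃ x e = s(x, x) := by
  simp [pocketEnds, hne, he]

/-- Edges off `P` keep their ends. -/
lemma pocketEnds_of_not_mem {e₀ e : E} (hne : e ≠ e₀) (he : e ∉ P) (a₃ x : V) :
    pocketEnds ends P e₀ a₃ x e = ends e := by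
  simp [pocketEnds, hne, he]

/-- `e₀` is open in the contracted configuration iff `a₃ ↔ x` through `P`. -/
lemma pocketCfg_self (e₀ : E) (a₃ x : V) (ω : Config E) :
    pocketCfg ends P e₀ a₃ x ω e₀ = true ↔ Conn ends (inOnly P ω) a₃ x := by
  simp [pocketCfg]

/-- Off `e₀` the contracted configuration is the outside part. -/
lemma pocketCfg_of_ne {e₀ e : E} (hne : e ≠ e₀) (a₃ x : V) (ω : Config E) :
    pocketCfg ends P e₀ a₃ x ω e = outOnly P ω e := by
  simp [pocketCfg, Function.update_of_ne hne]

/-- The other edges of `P` are closed in the contracted configuration. -/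
lemma pocketCfg_of_mem {e₀ e : E} (hne : e ≠ e₀) (he : e ∈ P) (a₃ x : V) (ω : Config E) :
    pocketCfg ends P e₀ a₃ x ω e = false := by
  rw [pocketCfg_of_ne hne]
  simp [he]

/-- Edges off `P` keep their state. -/
lemma pocketCfg_of_not_mem {e₀ e : E} (hne : e ≠ e₀) (he : e ∉ P) (a₃ x : V) (ω : Config E) :
    pocketCfg ends P e₀ a₃ x ω e = ω e := by
  rw [pocketCfg_of_ne hne]
  simp [he]

/-- The contracted configuration of a merge. -/
lemma pocketCfg_merge (e₀ : E) (a₃ x : V) (ω₂ ω₁ : Config E) :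
    pocketCfg ends P e₀ a₃ x (merge P ω₂ ω₁) =
      Function.update (outOnly P ω₁) e₀
        (@decide (Conn ends (inOnly P ω₂) a₃ x) (Classical.dec _)) := by
  simp only [pocketCfg, outOnly_merge]
  congr 1
  exact decide_eq_decide.mpr (by rw [inOnly_merge])

/-- **In the contracted graph `a₃` is a leaf at `x`.** -/
lemma IsPocket.isLeafAt_pocketEnds (h : IsPocket ends W x P) (e₀ : E) {a₃ : V} (ha : a₃ ∈ W) : IsLeafAt (pocketEnds ends P e₀ a₃ x) x a₃ e₀ where
  ends_eq := pocketEnds_self e₀ a₃ x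
  unique := by
    intro e hmem
    by_contra hne
    by_cases heP : e ∈ P
    · rw [pocketEnds_of_mem hne heP] at hmem
      rw [Sym2.mem_iff] at hmem
      have : a₃ = x := by rcases hmem with h' | h' <;> exact h'
      exact h.x_not_mem (this ▸ ha)
    · rw [pocketEnds_of_not_mem hne heP] at hmem
      exact heP (h.mem_P ha hmem)
  ne := fun hxa => h.x_not_mem (hxa ▸ ha)

end PocketDefs

/-! ## The push-forward of the product law -/

section PocketMeasure
variable {V : Type*} {E : Type*} [Fintype E] [DecidableEq E] {R : Type*} [CommRing R]

/-- The probability that `a₃ ↔ x` through the edges of `P` alone. -/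
noncomputable def pocketProb (p : E → R) (ends : E → Sym2 V) (P : Finset E) (a₃ x : V) : R :=
  prob (inW P p) (inOnly P ⁻¹' connEvent ends a₃ x)

/-- The contracted weights: `pocketProb` at `e₀`, `0` on the other edges of `P`, `p` elsewhere. -/
noncomputable def pocketW (p : E → R) (ends : E → Sym2 V) (P : Finset E) (e₀ : E) (a₃ x : V) :
    E → R :=
  fun e => if e = e₀ then pocketProb p ends P a₃ x else if e ∈ P then 0 else p e

/-- Linearity in the form used below. -/
lemma expect_mul_add_mul (q : E → R) (c d : R) (f g : Config E → R) :
    expect q (fun ω => c * f ω + d * g ω) = c * expect q f + d * expect q g := by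
  simp only [expect, Finset.mul_sum, ← Finset.sum_add_distrib]
  exact Finset.sum_congr rfl fun ω _ => by ring

variable (p : E → R) (ends : E → Sym2 V) (P : Finset E) (e₀ : E) (a₃ x : V)

/-- The contracted weight of `e₀` is `pocketProb`. -/
@[simp] lemma pocketW_self : pocketW p ends P e₀ a₃ x e₀ = pocketProb p ends P a₃ x := by
  simp [pocketW]

/-- Off `e₀` the contracted weights are the outside weights. -/
lemma pocketW_of_ne {e : E} (hne : e ≠ e₀) : pocketW p ends P e₀ a₃ x e = outW P p e := by
  by_cases he : e ∈ P <;> simp [pocketW, outW, hne, he]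

/-- **Push-forward of the product law under the contraction**: the expectation of a function of the
contracted configuration is its expectation under the contracted weights. -/
theorem expect_pocket (f : Config E → R) :
    expect p (fun ω => f (pocketCfg ends P e₀ a₃ x ω)) = expect (pocketW p ends P e₀ a₃ x) f := by
  set π := pocketProb p ends P a₃ x with hπ
  -- the left side: split along `P`, the inner expectation is a Bernoulli mixture in `e₀`
  have hin : ∀ ω₁ : Config E,
      expect (inW P p) (fun ω₂ => f (pocketCfg ends P e₀ a₃ x (merge P ω₂ ω₁))) =
        π * f (Function.update (outOnly P ω₁) e₀ true) +
          (1 - π) * f (Function.update (outOnly P ω₁) e₀ false) := by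
    intro ω₁
    simp only [pocketCfg_merge]
    have hb := expect_bool_split (inW P p)
      (fun ω₂ => @decide (Conn ends (inOnly P ω₂) a₃ x) (Classical.dec _))
      (fun c => f (Function.update (outOnly P ω₁) e₀ c))
    have hset : {ω : Config E | @decide (Conn ends (inOnly P ω) a₃ x) (Classical.dec _) = true} =
        inOnly P ⁻¹' connEvent ends a₃ x := by
      ext ω
      simp [connEvent]
    refine hb.trans ?_
    simp only [hset, hπ, pocketProb]
    ring
  have hL : expect p (fun ω => f (pocketCfg ends P e₀ a₃ x ω)) =
      π * expect (outW P p) (fun ω => f (Function.update ω e₀ true)) +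
        (1 - π) * expect (outW P p) (fun ω => f (Function.update ω e₀ false)) := by
    rw [expect_split P]
    simp only [hin]
    refine (expect_outW_outOnly P p (fun ω₁ => π * f (Function.update ω₁ e₀ true) +
      (1 - π) * f (Function.update ω₁ e₀ false))).symm.trans ?_
    exact expect_mul_add_mul (outW P p) π (1 - π) (fun ω => f (Function.update ω e₀ true))
      (fun ω => f (Function.update ω e₀ false))
  -- the right side: pin `e₀`, the other weights agree with `outW P p`
  have hR : expect (pocketW p ends P e₀ a₃ x) f =
      π * expect (outW P p) (fun ω => f (Function.update ω e₀ true)) +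
        (1 - π) * expect (outW P p) (fun ω => f (Function.update ω e₀ false)) := by
    rw [expect_eq_update_pin (pocketW p ends P e₀ a₃ x) f e₀, pocketW_self]
    have hT := expect_congr_of_ignore (pocketW p ends P e₀ a₃ x) (outW P p) e₀
      (fun e hne => pocketW_of_ne p ends P e₀ a₃ x hne)
      (fun ω => f (Function.update ω e₀ true)) (fun ω c => by simp only [Function.update_idem])
    have hF := expect_congr_of_ignore (pocketW p ends P e₀ a₃ x) (outW P p) e₀
      (fun e hne => pocketW_of_ne p ends P e₀ a₃ x hne)
      (fun ω => f (Function.update ω e₀ false)) (fun ω c => by simp only [Function.update_idem])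
    rw [hT, hF]
  rw [hL, hR]

/-- Push-forward of the product law under the contraction, for events. -/
theorem prob_pocket (A : Set (Config E)) :
    prob p (pocketCfg ends P e₀ a₃ x ⁻¹' A) = prob (pocketW p ends P e₀ a₃ x) A := by
  rw [prob_eq_expect_indicator, prob_eq_expect_indicator, ← expect_pocket p ends P e₀ a₃ x]
  rfl

end PocketMeasure

section PocketOrder
variable {V : Type*} {E : Type*} [Fintype E] [DecidableEq E] {R : Type*} [CommRing R]
  [PartialOrder R] [IsOrderedRing R]

/-- The contracted weights of a probability vector form a probability vector. -/
lemma IsProbVec.pocketW {p : E → R} (hp : IsProbVec p) (ends : E → Sym2 V) (P : Finset E) (e₀ : E)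
    (a₃ x : V) : IsProbVec (CaseOne.pocketW p ends P e₀ a₃ x) := by
  have hin : IsProbVec (CaseOne.inW P p) := CaseOne.IsProbVec.inW P hp
  refine ⟨fun e => ?_, fun e => ?_⟩
  · by_cases hne : e = e₀
    · subst hne
      rw [pocketW_self]
      exact prob_nonneg hin _
    · rw [pocketW_of_ne p ends P e₀ a₃ x hne]
      exact (CaseOne.IsProbVec.outW P hp).nonneg e
  · by_cases hne : e = e₀
    · subst hne
      rw [pocketW_self]
      exact prob_le_one hin _
    · rw [pocketW_of_ne p ends P e₀ a₃ x hne]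
      exact (CaseOne.IsProbVec.outW P hp).le_one e

end PocketOrder

end CaseOne

end Summit.Ventures.PercRepro2
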